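import Summits.PneNP.PneNP.Theorems.ConvexRankGatesCaptureDualRealCorankLemmas
import Literature.Combinatorics.SimpleGraph.LovaszThetaDual
import Mathlib.Analysis.LocallyConvex.Separation
import Mathlib.Topology.Instances.Matrix
import HarnessLib

/-!
# Crux `Capture` (stmt-PneNP-2659) — duality audit, cell D7 (lemmas): EXACT infeasibility
# certificates for TRACE-BOUNDED SDP-feasibility systems (the SDP slice of CONV)

The duality audit of the crux (`Cruxes/Capture/DUALITY-AUDIT-c7.md`) left one structurally decidable
cell open: is the CONV class itself — SDP-feasibility gates `v ↦ [∃ Y ⪰ 0, tr(Aᵢ Y) ≤ bᵢ + (B[v])ᵢ ∀ i]`,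
`B ≥ 0` — closed under Boolean duality `f ↦ (v ↦ ¬ f(¬ v))`? Plain conic Farkas certifies only STRONG
infeasibility (weakly infeasible SDPs have no certificate), which is why the cell was left open. The way
round it used here: a CONV gate has finitely many inputs, so it may be re-represented with a TRACE BOUND
`tr Y ≤ T` (`T` ≥ the trace of one chosen witness per accepted input) without changing the Boolean function;
and for the trace-bounded system the set of dominated right-hand sides

  `S = {(u, t) : ∃ Y ⪰ 0, tr(A_r Y) ≤ u_r ∀ r, tr Y ≤ t}`

is CLOSED (`isClosed_sdpDominated`: the trace bound makes the witnesses range over a compact set,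
`isCompact_setOf_posSemidef_trace_le`, via `|Y_{uv}| ≤ tr Y`). Separating an infeasible right-hand side
`(c, T) ∉ S` from `S` (Mathlib's geometric Hahn–Banach) and reading the functional in coordinates gives an
EXACT certificate (`exists_cert_of_sdp_infeasible`):

  `z ≥ 0`, `λ ≥ 0`, `½ Σ_r z_r (A_r + A_rᵀ) + λ I ⪰ 0`, `Σ_r z_r c_r + λ T ≤ −1`,

which is also sufficient (`sdp_infeasible_of_cert`, by `tr(P Y) ≥ 0` for `P, Y ⪰ 0`); together
`sdp_infeasible_iff_cert`. The certificate conditions are an SDP in `(z, λ, P)` in which the right-hand side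
`c` enters only through the scalar `Σ_r z_r c_r` — exactly the shape that the big-`M` linearisation of the LP
cell (`dualLP_isConvGate`) turns into ONE CONV gate; the gate is assembled in
`ConvexRankGatesCaptureDualSDP.lean` (`dualSDP_isConvGate`). [folklore; e.g. Ramana–Tunçel–Wolkowicz 1997 §2
for the role of closedness of the image cone]
-/

namespace Summit.PneNP.PneNP.Theorems.Capture.DualityAudit

set_option linter.dupNamespace false -- `Summit.PneNP.PneNP.…`: summit = sub-problem (D-0017)

open Literature.Computability.Complexity Finset Matrix Filter Topology
open Literature.Combinatorics.SimpleGraph (trace_mul_nonneg_of_posSemidef two_mul_apply_le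
  neg_two_mul_apply_le trace_mul_eq_sum_of_transpose)

noncomputable section

variable {R Q : Type} [Fintype R] [DecidableEq R] [Fintype Q] [DecidableEq Q]

/-! ### Positive semidefinite bookkeeping -/

omit [Fintype R] [DecidableEq R] in
/-- Entries of a real positive semidefinite matrix are bounded by its trace: `|Y_{uv}| ≤ tr Y`
(`2|Y_{uv}| ≤ Y_{uu} + Y_{vv}` and the diagonal is non-negative with sum `tr Y`). [folklore] -/
theorem abs_apply_le_trace_of_posSemidef {Y : Matrix Q Q ℝ} (hY : Y.PosSemidef) (u v : Q) :
    |Y u v| ≤ Y.trace := by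
  have h1 := two_mul_apply_le hY u v
  have h2 := neg_two_mul_apply_le hY u v
  have hdiag : ∀ w, Y w w ≤ Y.trace := fun w => by
    have h := Finset.single_le_sum (f := fun w => Y w w) (fun w _ => hY.diag_nonneg) (Finset.mem_univ w)
    simpa [Matrix.trace] using h
  have hu := hdiag u
  have hv := hdiag v
  rw [abs_le]
  constructor <;> linarith

omit [Fintype R] [DecidableEq R] [Fintype Q] [DecidableEq Q] in
/-- A real positive semidefinite matrix is symmetric. [folklore] -/
theorem transpose_eq_of_posSemidef {Y : Matrix Q Q ℝ} (hY : Y.PosSemidef) : Yᵀ = Y := by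
  have h := hY.1
  rwa [Matrix.IsHermitian, conjTranspose_eq_transpose_of_trivial] at h

omit [Fintype R] [DecidableEq R] in
/-- **The trace-bounded positive semidefinite matrices form a compact set** (closed, and inside the
box `|Y_{uv}| ≤ T`). [folklore] -/
theorem isCompact_setOf_posSemidef_trace_le (T : ℝ) :
    IsCompact {Y : Matrix Q Q ℝ | Y.PosSemidef ∧ Y.trace ≤ T} := by
  have hbox : IsCompact (Set.pi Set.univ fun _ : Q => Set.pi Set.univ fun _ : Q => Set.Icc (-T) T) :=
    isCompact_univ_pi fun _ => isCompact_univ_pi fun _ => isCompact_Icc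
  refine hbox.of_isClosed_subset ?_ ?_
  · have hset : {Y : Matrix Q Q ℝ | Y.PosSemidef ∧ Y.trace ≤ T} =
        ({B : Matrix Q Q ℝ | Bᴴ = B} ∩ ⋂ x : Q → ℝ, {B : Matrix Q Q ℝ | 0 ≤ x ⬝ᵥ (B *ᵥ x)}) ∩
          {B : Matrix Q Q ℝ | B.trace ≤ T} := by
      ext B
      simp only [Set.mem_setOf_eq, Set.mem_inter_iff, Set.mem_iInter, posSemidef_iff_dotProduct_mulVec,
        star_trivial]
      rfl
    rw [hset]
    refine IsClosed.inter (IsClosed.inter (isClosed_eq continuous_id.matrix_conjTranspose continuous_id)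
      (isClosed_iInter fun x => isClosed_le continuous_const ?_))
      (isClosed_le continuous_id.matrix_trace continuous_const)
    exact Continuous.dotProduct continuous_const (continuous_id.matrix_mulVec continuous_const)
  · rintro Y ⟨hY, htr⟩
    simp only [Set.mem_pi, Set.mem_univ, forall_true_left, Set.mem_Icc]
    exact fun u v => abs_le.1 ((abs_apply_le_trace_of_posSemidef hY u v).trans htr)

/-! ### The dominated right-hand-side set of a trace-bounded SDP system is closed and convex -/

omit [DecidableEq R] in
/-- **Closedness**: `S = {(u, t) : ∃ Y ⪰ 0, tr(A_r Y) ≤ u_r ∀ r, tr Y ≤ t}` is closed — along a convergent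
sequence in `S` the trace bounds are bounded, so the witnesses lie in a compact set and a limit witness
exists. [folklore] -/
theorem isClosed_sdpDominated (A : R → Matrix Q Q ℝ) :
    IsClosed {x : (R → ℝ) × ℝ | ∃ Y : Matrix Q Q ℝ, Y.PosSemidef ∧
      (∀ r, (A r * Y).trace ≤ x.1 r) ∧ Y.trace ≤ x.2} := by
  haveI : FirstCountableTopology (Matrix Q Q ℝ) := inferInstanceAs (FirstCountableTopology (Q → Q → ℝ))
  refine IsSeqClosed.isClosed fun xs x hxs hx => ?_
  choose Y hY using hxs
  have hx2 : Tendsto (fun n => (xs n).2) atTop (𝓝 x.2) := (continuous_snd.tendsto x).comp hx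
  obtain ⟨T, hT⟩ := hx2.bddAbove_range
  have hYK : ∀ n, Y n ∈ {Z : Matrix Q Q ℝ | Z.PosSemidef ∧ Z.trace ≤ T} := fun n =>
    ⟨(hY n).1, (hY n).2.2.trans (hT ⟨n, rfl⟩)⟩
  obtain ⟨Z, ⟨hZ, -⟩, φ, hφ, hlim⟩ := (isCompact_setOf_posSemidef_trace_le T).tendsto_subseq hYK
  refine ⟨Z, hZ, fun r => ?_, ?_⟩
  · have h1 : Tendsto (fun n => (A r * Y (φ n)).trace) atTop (𝓝 ((A r * Z).trace)) :=
      ((continuous_const.matrix_mul continuous_id).matrix_trace.tendsto Z).comp hlim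
    have h2 : Tendsto (fun n => (xs (φ n)).1 r) atTop (𝓝 (x.1 r)) :=
      (((continuous_apply r).comp continuous_fst).tendsto x).comp (hx.comp hφ.tendsto_atTop)
    exact le_of_tendsto_of_tendsto' h1 h2 fun n => (hY (φ n)).2.1 r
  · have h1 : Tendsto (fun n => (Y (φ n)).trace) atTop (𝓝 Z.trace) :=
      (continuous_id.matrix_trace.tendsto Z).comp hlim
    have h2 : Tendsto (fun n => (xs (φ n)).2) atTop (𝓝 x.2) := hx2.comp hφ.tendsto_atTop
    exact le_of_tendsto_of_tendsto' h1 h2 fun n => (hY (φ n)).2.2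

omit [Fintype R] [DecidableEq R] [DecidableEq Q] in
/-- **Convexity** of the same set (convex combinations of witnesses). [folklore] -/
theorem convex_sdpDominated (A : R → Matrix Q Q ℝ) :
    Convex ℝ {x : (R → ℝ) × ℝ | ∃ Y : Matrix Q Q ℝ, Y.PosSemidef ∧
      (∀ r, (A r * Y).trace ≤ x.1 r) ∧ Y.trace ≤ x.2} := by
  rintro x ⟨Y₁, hY₁, hc₁, ht₁⟩ y ⟨Y₂, hY₂, hc₂, ht₂⟩ a b ha hb -
  refine ⟨a • Y₁ + b • Y₂, (hY₁.smul ha).add (hY₂.smul hb), fun r => ?_, ?_⟩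
  · have h1 := mul_le_mul_of_nonneg_left (hc₁ r) ha
    have h2 := mul_le_mul_of_nonneg_left (hc₂ r) hb
    simp only [Matrix.mul_add, Matrix.mul_smul, trace_add, trace_smul, smul_eq_mul, Prod.fst_add,
      Prod.smul_fst, Pi.add_apply, Pi.smul_apply]
    linarith
  · have h1 := mul_le_mul_of_nonneg_left ht₁ ha
    have h2 := mul_le_mul_of_nonneg_left ht₂ hb
    simp only [trace_add, trace_smul, smul_eq_mul, Prod.snd_add, Prod.smul_snd]
    linarith

/-! ### The certificate matrix `½ Σ_r z_r (A_r + A_rᵀ) + λ I` -/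

omit [Fintype R] [DecidableEq R] [DecidableEq Q] in
/-- `tr(Aᵀ Y) = tr(A Y)` for symmetric `Y`. [folklore] -/
theorem trace_transpose_mul_of_symm (A : Matrix Q Q ℝ) {Y : Matrix Q Q ℝ} (hY : Yᵀ = Y) :
    (Aᵀ * Y).trace = (A * Y).trace := by
  rw [← trace_transpose, transpose_mul, transpose_transpose, hY, trace_mul_comm]

omit [DecidableEq R] in
/-- **Pairing the certificate matrix with a symmetric `Y`**:
`tr((½ Σ_r z_r (A_r + A_rᵀ) + λ I) Y) = Σ_r z_r tr(A_r Y) + λ tr Y`. [folklore] -/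
theorem trace_certMat_mul (A : R → Matrix Q Q ℝ) (z : R → ℝ) (lam : ℝ) {Y : Matrix Q Q ℝ}
    (hY : Yᵀ = Y) :
    (((2 : ℝ)⁻¹ • ∑ r, z r • (A r + (A r)ᵀ) + lam • (1 : Matrix Q Q ℝ)) * Y).trace =
      ∑ r, z r * (A r * Y).trace + lam * Y.trace := by
  simp only [Matrix.add_mul, Matrix.smul_mul, Matrix.sum_mul, Matrix.one_mul, trace_add, trace_smul,
    trace_sum, smul_eq_mul, trace_transpose_mul_of_symm _ hY]
  rw [Finset.mul_sum]
  congr 1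
  exact Finset.sum_congr rfl fun r _ => by ring

omit [DecidableEq R] [Fintype Q] in
/-- The certificate matrix is symmetric. [folklore] -/
theorem certMat_transpose (A : R → Matrix Q Q ℝ) (z : R → ℝ) (lam : ℝ) :
    ((2 : ℝ)⁻¹ • ∑ r, z r • (A r + (A r)ᵀ) + lam • (1 : Matrix Q Q ℝ))ᵀ =
      (2 : ℝ)⁻¹ • ∑ r, z r • (A r + (A r)ᵀ) + lam • (1 : Matrix Q Q ℝ) := by
  simp only [transpose_add, transpose_smul, transpose_one, Matrix.transpose_sum, transpose_transpose]
  congr 2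
  exact Finset.sum_congr rfl fun r _ => by rw [add_comm]

omit [Fintype R] [DecidableEq R] [DecidableEq Q] in
/-- `xᵀ N x = tr(N · x xᵀ)`. [folklore] -/
theorem dotProduct_mulVec_eq_trace_mul_vecMulVec (N : Matrix Q Q ℝ) (x : Q → ℝ) :
    x ⬝ᵥ (N *ᵥ x) = (N * vecMulVec x x).trace := by
  rw [Matrix.mul_vecMulVec, trace_vecMulVec, dotProduct_comm]

/-! ### Exact certificates -/

omit [DecidableEq R] in
/-- **Soundness of certificates** (weak duality): `z ≥ 0`, `λ ≥ 0`, `P = ½ Σ_r z_r (A_r + A_rᵀ) + λ I ⪰ 0`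
and `Σ_r z_r c_r + λ T < 0` exclude every `Y ⪰ 0` with `tr(A_r Y) ≤ c_r`, `tr Y ≤ T`
(`0 ≤ tr(P Y) = Σ z_r tr(A_r Y) + λ tr Y ≤ Σ z_r c_r + λ T < 0`). [folklore] -/
theorem sdp_infeasible_of_cert (A : R → Matrix Q Q ℝ) (c : R → ℝ) (T : ℝ) (z : R → ℝ) (lam : ℝ)
    (hz : ∀ r, 0 ≤ z r) (hlam : 0 ≤ lam)
    (hP : ((2 : ℝ)⁻¹ • ∑ r, z r • (A r + (A r)ᵀ) + lam • (1 : Matrix Q Q ℝ)).PosSemidef)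
    (hneg : ∑ r, z r * c r + lam * T < 0) :
    ¬ ∃ Y : Matrix Q Q ℝ, Y.PosSemidef ∧ (∀ r, (A r * Y).trace ≤ c r) ∧ Y.trace ≤ T := by
  rintro ⟨Y, hY, hc, htr⟩
  have hYsymm : Yᵀ = Y := transpose_eq_of_posSemidef hY
  have h0 := trace_mul_nonneg_of_posSemidef hP hY
  rw [trace_certMat_mul A z lam hYsymm] at h0
  have h1 : ∑ r, z r * (A r * Y).trace ≤ ∑ r, z r * c r :=
    Finset.sum_le_sum fun r _ => mul_le_mul_of_nonneg_left (hc r) (hz r)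
  have h2 : lam * Y.trace ≤ lam * T := mul_le_mul_of_nonneg_left htr hlam
  linarith

omit [Fintype Q] [DecidableEq Q] in
/-- A continuous linear functional on `ℝ^R × ℝ` in coordinates:
`f(x₁, x₂) = Σ_r x₁(r) f(e_r, 0) + x₂ f(0, 1)`. [folklore] -/
theorem strongDual_prod_apply (f : StrongDual ℝ ((R → ℝ) × ℝ)) (x₁ : R → ℝ) (x₂ : ℝ) :
    f (x₁, x₂) = ∑ r, x₁ r * f ((fun j => if r = j then 1 else 0), 0) + x₂ * f (0, 1) := by
  have h1 : ((x₁, x₂) : (R → ℝ) × ℝ) = (x₁, (0 : ℝ)) + ((0 : R → ℝ), x₂) := by simp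
  have h2 : (((0 : R → ℝ), x₂) : (R → ℝ) × ℝ) = x₂ • ((0 : R → ℝ), (1 : ℝ)) := by simp
  rw [h1, map_add, h2, map_smul, smul_eq_mul]
  congr 1
  set φ : (R → ℝ) →ₗ[ℝ] ℝ :=
    (f : (R → ℝ) × ℝ →L[ℝ] ℝ).toLinearMap.comp (LinearMap.inl ℝ (R → ℝ) ℝ) with hφ
  have h3 : f (x₁, 0) = φ x₁ := rfl
  rw [h3, LinearMap.pi_apply_eq_sum_univ φ x₁]
  rfl

/-- **Exact certificates of infeasibility for trace-bounded SDP systems** (the separation step): if no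
`Y ⪰ 0` has `tr(A_r Y) ≤ c_r` for all `r` and `tr Y ≤ T`, then there are `z ≥ 0`, `λ ≥ 0` with
`½ Σ_r z_r (A_r + A_rᵀ) + λ I ⪰ 0` and `Σ_r z_r c_r + λ T ≤ −1`. Proof: separate `(c, T)` from the closed
convex set `S` of dominated right-hand sides (`geometric_hahn_banach_point_closed`); `0 ∈ S` makes the level
negative, the recession directions `+e_r`, `+e` make the coefficients non-negative, the cone
`{(tr(A_r Y))_r, tr Y) : Y ⪰ 0} ⊆ S` makes the certificate matrix positive semidefinite (test `Y = x xᵀ`),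
and rescaling normalises the level to `−1`. [folklore] -/
theorem exists_cert_of_sdp_infeasible (A : R → Matrix Q Q ℝ) (c : R → ℝ) (T : ℝ)
    (hinf : ¬ ∃ Y : Matrix Q Q ℝ, Y.PosSemidef ∧ (∀ r, (A r * Y).trace ≤ c r) ∧ Y.trace ≤ T) :
    ∃ (z : R → ℝ) (lam : ℝ), (∀ r, 0 ≤ z r) ∧ 0 ≤ lam ∧
      ((2 : ℝ)⁻¹ • ∑ r, z r • (A r + (A r)ᵀ) + lam • (1 : Matrix Q Q ℝ)).PosSemidef ∧
      ∑ r, z r * c r + lam * T ≤ -1 := by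
  classical
  set S : Set ((R → ℝ) × ℝ) := {x | ∃ Y : Matrix Q Q ℝ, Y.PosSemidef ∧
      (∀ r, (A r * Y).trace ≤ x.1 r) ∧ Y.trace ≤ x.2} with hS
  have hcT : ((c, T) : (R → ℝ) × ℝ) ∉ S := fun ⟨Y, hY, hc, ht⟩ => hinf ⟨Y, hY, hc, ht⟩
  obtain ⟨f, u₀, hfc, hfS⟩ :=
    geometric_hahn_banach_point_closed (convex_sdpDominated A) (isClosed_sdpDominated A) hcT
  -- coordinates of `f`
  set w : R → ℝ := fun r => f ((fun j => if r = j then 1 else 0), 0) with hw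
  set μ : ℝ := f (0, 1) with hμ
  have hf : ∀ (x₁ : R → ℝ) (x₂ : ℝ), f (x₁, x₂) = ∑ r, x₁ r * w r + x₂ * μ :=
    fun x₁ x₂ => strongDual_prod_apply f x₁ x₂
  -- `0 ∈ S`, so the level is negative
  have h0S : ((0 : R → ℝ), (0 : ℝ)) ∈ S :=
    ⟨0, PosSemidef.zero, fun r => by simp, by simp⟩
  have hu₀ : u₀ < 0 := by
    have h := hfS _ h0S
    have h0 : f ((0 : R → ℝ), (0 : ℝ)) = 0 := by
      rw [show ((0 : R → ℝ), (0 : ℝ)) = (0 : (R → ℝ) × ℝ) from rfl, map_zero]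
    linarith
  -- recession directions: the coefficients are non-negative
  have hw0 : ∀ r, 0 ≤ w r := fun r => by
    by_contra hneg
    push Not at hneg
    set s : ℝ := u₀ / w r with hs
    have hs0 : 0 ≤ s := (div_pos_of_neg_of_neg hu₀ hneg).le
    have hmem : ((s • fun j => if r = j then (1 : ℝ) else 0), (0 : ℝ)) ∈ S := by
      refine ⟨0, PosSemidef.zero, fun r' => ?_, by simp⟩
      simp only [Matrix.mul_zero, trace_zero, Pi.smul_apply, smul_eq_mul]
      split_ifs
      · simpa using hs0
      · simp
    have h := hfS _ hmem
    rw [hf] at h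
    have hval : ∑ r', (s • fun j => if r = j then (1 : ℝ) else 0) r' * w r' = s * w r := by
      simp only [Pi.smul_apply, smul_eq_mul, mul_ite, mul_one, mul_zero, ite_mul, zero_mul]
      rw [Finset.sum_ite_eq, if_pos (Finset.mem_univ r)]
    rw [hval, zero_mul, add_zero] at h
    have hsw : s * w r = u₀ := by rw [hs]; exact div_mul_cancel₀ u₀ hneg.ne
    linarith
  have hμ0 : 0 ≤ μ := by
    by_contra hneg
    push Not at hneg
    set s : ℝ := u₀ / μ with hs
    have hs0 : 0 ≤ s := (div_pos_of_neg_of_neg hu₀ hneg).le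
    have hmem : ((0 : R → ℝ), s) ∈ S :=
      ⟨0, PosSemidef.zero, fun r' => by simp, by simpa using hs0⟩
    have h := hfS _ hmem
    rw [hf] at h
    simp only [Pi.zero_apply, zero_mul, Finset.sum_const_zero, zero_add] at h
    have hsw : s * μ = u₀ := by rw [hs]; exact div_mul_cancel₀ u₀ hneg.ne
    linarith
  -- the cone of exact right-hand sides lies in `S`: the certificate functional is non-negative on it
  have hcone : ∀ Y : Matrix Q Q ℝ, Y.PosSemidef → 0 ≤ ∑ r, w r * (A r * Y).trace + μ * Y.trace := by
    intro Y hY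
    by_contra hneg
    push Not at hneg
    set β : ℝ := ∑ r, w r * (A r * Y).trace + μ * Y.trace with hβ
    set t : ℝ := u₀ / β with ht
    have ht0 : 0 ≤ t := (div_pos_of_neg_of_neg hu₀ hneg).le
    have hmem : ((fun r => (A r * (t • Y)).trace), (t • Y).trace) ∈ S :=
      ⟨t • Y, hY.smul ht0, fun r => le_rfl, le_rfl⟩
    have h := hfS _ hmem
    rw [hf] at h
    have hval : ∑ r, (A r * (t • Y)).trace * w r + (t • Y).trace * μ = t * β := by
      simp only [Matrix.mul_smul, trace_smul, smul_eq_mul, hβ, mul_add, Finset.mul_sum]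
      congr 1
      · exact Finset.sum_congr rfl fun r _ => by ring
      · ring
    rw [hval] at h
    have htβ : t * β = u₀ := by rw [ht]; exact div_mul_cancel₀ u₀ hneg.ne
    linarith
  -- rescale by `κ = -f(c, T) > 0`
  have hfcT : f (c, T) < 0 := hfc.trans hu₀
  set κ : ℝ := -f (c, T) with hκdef
  have hκ : 0 < κ := by rw [hκdef]; linarith
  have hκinv : 0 ≤ κ⁻¹ := inv_nonneg.2 hκ.le
  refine ⟨fun r => κ⁻¹ * w r, κ⁻¹ * μ, fun r => mul_nonneg hκinv (hw0 r), mul_nonneg hκinv hμ0, ?_, ?_⟩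
  · -- positive semidefiniteness: the rescaled matrix is `κ⁻¹ • C₀`, and `xᵀ C₀ x = Σ w_r tr(A_r xxᵀ) + μ |x|²`
    have hscale : κ⁻¹ • ((2 : ℝ)⁻¹ • ∑ r, w r • (A r + (A r)ᵀ) + μ • (1 : Matrix Q Q ℝ)) =
        (2 : ℝ)⁻¹ • ∑ r, (κ⁻¹ * w r) • (A r + (A r)ᵀ) + (κ⁻¹ * μ) • (1 : Matrix Q Q ℝ) := by
      rw [smul_add]
      congr 1
      · rw [smul_comm]
        congr 1
        rw [Finset.smul_sum]
        exact Finset.sum_congr rfl fun r _ => by rw [smul_smul]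
      · rw [smul_smul]
    rw [← hscale]
    refine PosSemidef.smul ?_ hκinv
    refine PosSemidef.of_dotProduct_mulVec_nonneg ?_ fun x => ?_
    · rw [Matrix.IsHermitian, conjTranspose_eq_transpose_of_trivial]
      exact certMat_transpose A w μ
    · rw [star_trivial, dotProduct_mulVec_eq_trace_mul_vecMulVec,
        trace_certMat_mul A w μ (by rw [transpose_vecMulVec])]
      have hX : (vecMulVec x x).PosSemidef := by
        have h := posSemidef_vecMulVec_self_star (R := ℝ) x
        rwa [star_trivial] at h
      exact hcone _ hX
  · -- the level: `Σ κ⁻¹ w_r c_r + κ⁻¹ μ T = κ⁻¹ f(c, T) = -1`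
    have hval : ∑ r, κ⁻¹ * w r * c r + κ⁻¹ * μ * T = κ⁻¹ * f (c, T) := by
      rw [hf, mul_add, Finset.mul_sum]
      congr 1
      · exact Finset.sum_congr rfl fun r _ => by ring
      · ring
    rw [hval, show f (c, T) = -κ by rw [hκdef, neg_neg], mul_neg, inv_mul_cancel₀ hκ.ne']

/-- **Exact Farkas for trace-bounded SDP systems**: `{Y ⪰ 0 : tr(A_r Y) ≤ c_r ∀ r, tr Y ≤ T} = ∅` iff
there are `z ≥ 0`, `λ ≥ 0` with `½ Σ_r z_r (A_r + A_rᵀ) + λ I ⪰ 0` and `Σ_r z_r c_r + λ T ≤ −1`. No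
constraint qualification is needed: the trace bound closes the image cone. [folklore] -/
theorem sdp_infeasible_iff_cert : ∀ {R Q : Type} [Fintype R] [Fintype Q] [DecidableEq Q]
    (A : R → Matrix Q Q ℝ) (c : R → ℝ) (T : ℝ),
    (¬ ∃ Y : Matrix Q Q ℝ, Y.PosSemidef ∧ (∀ r, (A r * Y).trace ≤ c r) ∧ Y.trace ≤ T) ↔
      ∃ (z : R → ℝ) (lam : ℝ), (∀ r, 0 ≤ z r) ∧ 0 ≤ lam ∧
        ((2 : ℝ)⁻¹ • ∑ r, z r • (A r + (A r)ᵀ) + lam • (1 : Matrix Q Q ℝ)).PosSemidef ∧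
        ∑ r, z r * c r + lam * T ≤ -1 := by
  intro R Q _ _ _ A c T
  classical
  constructor
  · exact exists_cert_of_sdp_infeasible A c T
  · rintro ⟨z, lam, hz, hlam, hP, hle⟩
    exact sdp_infeasible_of_cert A c T z lam hz hlam hP (by linarith)

end

end Summit.PneNP.PneNP.Theorems.Capture.DualityAudit
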